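import Literature.MathematicalPhysics.QuantumFieldTheory.Balaban1983to89.Node00.Record13LiveSelectorFamily

/-!
# NODE 00 (YM-PLAN Track A) — STAGE 13: THE NUMERICS KEYED TO [15]'s CONSTANTS `(B₃, a₀, a₁)` — the ONE-DEF RE-PIN of the K0‴ witness at which
# node00-def-P11's letter inequalities («proper restrictions on ε_j», [III] p. 259) are THEOREMS — and the [15]-keyed witness `θ₁₅ = theta13OfThm1` with its faces

Cell `pub-ymgap`, seat `pub-ymgap-node00-def-K0a` (g4), FILE 10a (companion FILE 10b `Node00/Record13InhabitedOfThm1` composes it with node00-def-P11's supplier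
`Node00/Record13BgRow`).  Trigger (t3) of the K0a lineage: `Stage13Params.bg_of_thm1Scaled` (the BODY of `Provisos₁₃.bg` from (h15) `VariationalThm1Scaled F N B₃ a₀ a₁`
+ (ha₀) `εreg ≤ a₀` + (hnum) `0 < cR·ε_m ≤ a₁`, `B₃·cR·ε_m ≤ εreg` + (hBα) `B₃·cR·ε_m ≤ (1 − β)·α₀(g_m)` + two gauge clauses) is in the tree; node00-def-P11
LOCATED-P11-NUMERICS: at the witness of record (`εreg = A₀ = C₀ = 1`) the letter inequalities are NOT theorems for arbitrary `(B₃, a₀, a₁)` — the numerics must be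
carried as functions of [15]'s constants (vet of stmt-QuantumFields-19909: «a clause-I failure at θL is repaired by K0a's one-def re-pin, item untouched»; plan g66
`K0Skeleton13Live`: «K0a re-pins by ONE def … the skeleton is re-issued at the re-pinned witness»).  [I] = [Balaban1987RG1], [III] = [Balaban1988Convergent],
[IV] = [Balaban1989LargeFieldI], [15] = [Balaban1985Variational].

WHAT THIS FILE PROVIDES.
* §1 THE LETTERS: `A0OfThm1 B₃ a₀ a₁ := min a₁ (min a₀ ½) ∕ (1 + B₃)` (`0 < A₀ ≤ a₁`, `B₃·A₀ ≤ a₀`, `B₃·A₀ ≤ ½`); `numerics7OfThm1 ε₀ B₃ a₀ a₁` = the family's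
  Stage-7 numerics with `A₀ := A0OfThm1 …`, `εreg := a₀`; `stage12NumericsOfThm1 ε₀ B₃ a₀ a₁` = the family's Stage-12 numerics over it (so `γ = ½`, `cR = 1`,
  `β = ¼`, `C₀ = 1`, `q₀ = 2`, `p₀ = 1`, `κ = 2·10⁴` are THE FAMILY'S, `rfl`); `stage12NumericsOfThm1_pos` under the signs `0 < ε₀`, `0 ≤ B₃`, `0 < a₀`, `0 < a₁`.
* §2 WINDOW ⇒ LETTER INEQUALITIES, IN KERNEL: (private `mul_log_inv_sq_le_one`: `g·log g⁻² ≤ 1`), `epsOfRecord_le_A₀_of_p₀_eq_one` (`ε_m = g_m·A₀·log g_m⁻² ≤ A₀`),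
  `sq_le_exp_neg_one_of_le_half` (`g ≤ ½ ⇒ g² ≤ e⁻¹`), `window_sq_le_of_inInterval` (the `g_m² ≤ e⁻¹` input of def-P11's `bg_numerics_of_letters`),
  ★ `numerics_thm1_of_inInterval` (def-P11's (hnum) along every history in a window `]0, γ]`, `γ < 1`), `mul_A0_nonneg_thm1` ∕ `mul_A0_le_C₀_thm1`
  (`0 ≤ B₃·cR·A₀ ≤ (1 − β)·C₀`, the inputs of def-P11's `bg_numerics_of_letters`).
* §3 ★★ THE [15]-KEYED WITNESS `theta13OfThm1 F N ε₀ ε₂₉ B₃ a₀ a₁ := theta13LiveOfNumerics F N (stage12NumericsOfThm1 ε₀ B₃ a₀ a₁) ε₂₉ (ζ, Rz, Zt of record)`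
  (a MEMBER of FILE 9's all-numerics family, `rfl`), its `rfl` views and faces (`admissible_` under the five signs, `eight_le_L_`, `kp_tree_∕kp_large_∕kp_n10_`,
  `hasResidualsOfRecord_`, `ztUnity_`, `slotsNondegenerate₁₃_ (h)`).

HONEST FRAMING.  Bookkeeping of a re-pinned parameter family + elementary real inequalities; the numerals `A₀(B₃, a₀, a₁)`, `εreg := a₀` are displayed choices
meeting the letter inequalities for ANY values of print's undetermined constants `B₃ ≥ 0`, `a₀, a₁ > 0` — not Bałaban's constants; nothing of Bałaban asserted;
NOT a discharge; K0‴ NOT closed by this file; counts unmoved (typed 28∕28 · discharged 5∕28); one finite 𝕋⁴ programme at fixed ε — NOT continuum ∕ OS ∕ mass gap ∕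
Clay.  No `sorry`, no `axiom`, no `instance`, no `notation`.
-/

noncomputable section

open MeasureTheory
open scoped Matrix.Norms.L2Operator

namespace Literature.MathematicalPhysics.QuantumFieldTheory.Balaban1983to89.Node00

open T4Continuum B14.Eq218Concrete B15DeterminingSets B12RegularSpaces111 B14RegularSpaces234

/-! ## §1. The letters keyed to [15]'s constants `(B₃, a₀, a₁)` and the numerics carrying them -/

section Letters

/-- **THE SMALL-FIELD PROFILE CONSTANT KEYED TO [15]'s CONSTANTS**: `A₀(B₃, a₀, a₁) := min a₁ (min a₀ ½) ∕ (1 + B₃)` — chosen so that, with `cR = 1`, `p₀ = 1`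
and the window `]0, ½]`, the thresholds `ε_m = g_m A₀ log g_m⁻² ≤ A₀` meet `ε_m ≤ a₁`, `B₃·ε_m ≤ εreg := a₀` and `B₃·A₀ ≤ ½ ≤ (1 − β)·C₀` («proper restrictions on
ε_j», [III] p. 259; a displayed choice, not Bałaban's constant). [cite: Balaban1988Convergent, (2.4) p.255, (2.28) p.259; Balaban1985Variational, Thm 1 (7)–(8) p.279 (bookkeeping witness)] -/
def A0OfThm1 (B₃ a₀ a₁ : ℝ) : ℝ :=
  min a₁ (min a₀ (1 / 2)) / (1 + B₃)

variable {B₃ a₀ a₁ : ℝ}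

/-- `0 < A₀(B₃, a₀, a₁)` under print's signs. [cite: Balaban1988Convergent, (2.4) p.255 (bookkeeping)] -/
theorem A0OfThm1_pos (hB : 0 ≤ B₃) (ha₀ : 0 < a₀) (ha₁ : 0 < a₁) : 0 < A0OfThm1 B₃ a₀ a₁ :=
  div_pos (lt_min ha₁ (lt_min ha₀ one_half_pos)) (by linarith)

/-- `0 ≤ A₀(B₃, a₀, a₁)` under the weak signs. [cite: Balaban1988Convergent, (2.4) p.255 (bookkeeping)] -/
theorem A0OfThm1_nonneg (hB : 0 ≤ B₃) (ha₀ : 0 ≤ a₀) (ha₁ : 0 ≤ a₁) : 0 ≤ A0OfThm1 B₃ a₀ a₁ :=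
  div_nonneg (le_min ha₁ (le_min ha₀ (by norm_num))) (by linarith)

/-- `A₀(B₃, a₀, a₁) ≤ a₁`. [cite: Balaban1985Variational, Thm 1 (7) p.279 (bookkeeping)] -/
theorem A0OfThm1_le_a₁ (hB : 0 ≤ B₃) (ha₀ : 0 ≤ a₀) (ha₁ : 0 ≤ a₁) : A0OfThm1 B₃ a₀ a₁ ≤ a₁ := by
  unfold A0OfThm1
  have hm0 : 0 ≤ min a₁ (min a₀ (1 / 2)) := le_min ha₁ (le_min ha₀ (by norm_num))
  exact (div_le_self hm0 (by linarith)).trans (min_le_left _ _)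

/-- `B₃·A₀(B₃, a₀, a₁) ≤ a₀`. [cite: Balaban1985Variational, Thm 1 (8) p.279 (bookkeeping)] -/
theorem mul_A0OfThm1_le_a₀ (hB : 0 ≤ B₃) (ha₀ : 0 ≤ a₀) : B₃ * A0OfThm1 B₃ a₀ a₁ ≤ a₀ := by
  unfold A0OfThm1
  have hm : min a₁ (min a₀ (1 / 2)) ≤ a₀ := (min_le_right _ _).trans (min_le_left _ _)
  have h1 : (0 : ℝ) < 1 + B₃ := by linarith
  rw [mul_div_assoc', div_le_iff₀ h1]
  nlinarith [mul_le_mul_of_nonneg_left hm hB, mul_nonneg ha₀ hB]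

/-- `B₃·A₀(B₃, a₀, a₁) ≤ ½`. [cite: Balaban1988Convergent, (2.28) p.259 (bookkeeping)] -/
theorem mul_A0OfThm1_le_half (hB : 0 ≤ B₃) : B₃ * A0OfThm1 B₃ a₀ a₁ ≤ 1 / 2 := by
  unfold A0OfThm1
  have hm : min a₁ (min a₀ (1 / 2)) ≤ 1 / 2 := (min_le_right _ _).trans (min_le_right _ _)
  have h1 : (0 : ℝ) < 1 + B₃ := by linarith
  rw [mul_div_assoc', div_le_iff₀ h1]
  nlinarith [mul_le_mul_of_nonneg_left hm hB]

/-- **def-R's Stage-7 numerics KEYED TO [15]'s CONSTANTS**: the family's (`numerics7OfFamily ε₀`: `M₁ = M₂ = r = p₀ := 1`, `log σ₀ := 0`, `ε₀` the argument) with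
`A₀ := A0OfThm1 B₃ a₀ a₁` and `εreg := a₀` (the (2.12) class at [15]'s `a₀`). [cite: Balaban1988Convergent, (2.4) p.255, (2.12) p.256; Balaban1985Variational, Thm 1 p.279 (bookkeeping witness)] -/
def numerics7OfThm1 (ε₀ B₃ a₀ a₁ : ℝ) : Stage7Numerics :=
  { numerics7OfFamily ε₀ with A₀ := A0OfThm1 B₃ a₀ a₁, εreg := a₀ }

/-- Its (1.2) letter IS the argument (`rfl`). [cite: Balaban1987RG1, (1.2) p.260 (bookkeeping)] -/
theorem numerics7OfThm1_ε₀ (ε₀ B₃ a₀ a₁ : ℝ) : (numerics7OfThm1 ε₀ B₃ a₀ a₁).ε₀ = ε₀ := rfl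

/-- Its profile constant IS `A₀(B₃, a₀, a₁)` (`rfl`). [cite: Balaban1988Convergent, (2.4) p.255 (bookkeeping)] -/
theorem numerics7OfThm1_A₀ (ε₀ B₃ a₀ a₁ : ℝ) : (numerics7OfThm1 ε₀ B₃ a₀ a₁).A₀ = A0OfThm1 B₃ a₀ a₁ := rfl

/-- Its regularity threshold IS `a₀` (`rfl`). [cite: Balaban1985Variational, Thm 1 p.279 (bookkeeping)] -/
theorem numerics7OfThm1_εreg (ε₀ B₃ a₀ a₁ : ℝ) : (numerics7OfThm1 ε₀ B₃ a₀ a₁).εreg = a₀ := rfl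

/-- Its profile exponent is the family's `p₀ = 1` (`rfl`). [cite: Balaban1988Convergent, (2.4) p.255 (bookkeeping)] -/
theorem numerics7OfThm1_p₀ (ε₀ B₃ a₀ a₁ : ℝ) : (numerics7OfThm1 ε₀ B₃ a₀ a₁).p₀ = 1 := rfl

/-- **THE STAGE-12 NUMERICS KEYED TO [15]'s CONSTANTS**: the family's (`stage12NumericsOfFamily ε₀`: `γ := ½`, `εbg := 1`, `τ9` of record, `A₁ := 1`,
`s2 := sect2NumericsOfFamily` with `cR = 1`, `β = ¼`, `C₀ = 1`, `q₀ = 2`, `κ = 2·10⁴`) over `numerics7OfThm1 ε₀ B₃ a₀ a₁`. [cite: Balaban1988Convergent, (2.4) p.255, (2.10) p.256, (2.28) p.259; Balaban1987RG1, (0.21) p.256 (bookkeeping witness)] -/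
def stage12NumericsOfThm1 (ε₀ B₃ a₀ a₁ : ℝ) : Stage12Numerics :=
  { stage12NumericsOfFamily ε₀ with ν := numerics7OfThm1 ε₀ B₃ a₀ a₁ }

/-- Its Stage-7 part (`rfl`). [cite: Balaban1988Convergent, (2.4) p.255 (bookkeeping)] -/
theorem stage12NumericsOfThm1_ν (ε₀ B₃ a₀ a₁ : ℝ) : (stage12NumericsOfThm1 ε₀ B₃ a₀ a₁).ν = numerics7OfThm1 ε₀ B₃ a₀ a₁ := rfl

/-- Its §2 numerics ARE the family's (`rfl`). [cite: Balaban1988Convergent, (2.28) p.259 (bookkeeping)] -/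
theorem stage12NumericsOfThm1_s2 (ε₀ B₃ a₀ a₁ : ℝ) : (stage12NumericsOfThm1 ε₀ B₃ a₀ a₁).s2 = sect2NumericsOfFamily := rfl

/-- Its window constant is the family's `γ = ½` (`rfl`). [cite: Balaban1987RG1, Thm 1 p.255 (bookkeeping)] -/
theorem stage12NumericsOfThm1_γ (ε₀ B₃ a₀ a₁ : ℝ) : (stage12NumericsOfThm1 ε₀ B₃ a₀ a₁).γ = 1 / 2 := rfl

/-- Its located regularity constant is the family's `cR = 1` (`rfl`). [cite: Balaban1988Convergent, (2.10) p.256 (bookkeeping)] -/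
theorem stage12NumericsOfThm1_cR (ε₀ B₃ a₀ a₁ : ℝ) : (stage12NumericsOfThm1 ε₀ B₃ a₀ a₁).s2.cR = 1 := rfl

/-- Its (2.34) constant is the family's `β = ¼` (`rfl`). [cite: Balaban1988Convergent, (2.34) p.261 (bookkeeping)] -/
theorem stage12NumericsOfThm1_βc (ε₀ B₃ a₀ a₁ : ℝ) : (stage12NumericsOfThm1 ε₀ B₃ a₀ a₁).s2.βc = 1 / 4 := rfl

/-- Its term constants ARE the family's (`rfl`). [cite: Balaban1988Convergent, (2.28) p.259 (bookkeeping)] -/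
theorem stage12NumericsOfThm1_lf (ε₀ B₃ a₀ a₁ : ℝ) : (stage12NumericsOfThm1 ε₀ B₃ a₀ a₁).s2.lf = lfConstsOfFamily := rfl

/-- Its tower numerics ARE the record's (`rfl`). [cite: Balaban1989LargeFieldI, (2.1) p.182 (bookkeeping)] -/
theorem stage12NumericsOfThm1_τ9 (ε₀ B₃ a₀ a₁ : ℝ) : (stage12NumericsOfThm1 ε₀ B₃ a₀ a₁).τ9 = towerNumericsOfRecord₁₂ := rfl

/-- Its (1.16) constant is the family's `A₁ = 1` (`rfl`). [cite: Balaban1987RG1, (1.16) p.262 (bookkeeping)] -/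
theorem stage12NumericsOfThm1_A₁ (ε₀ B₃ a₀ a₁ : ℝ) : (stage12NumericsOfThm1 ε₀ B₃ a₀ a₁).A₁ = 1 := rfl

variable {ε₀ : ℝ}

/-- **THE [15]-KEYED NUMERICS MEET EVERY SIGN WINDOW** (`Stage12Numerics.Pos`) under `0 < ε₀`, `0 ≤ B₃`, `0 < a₀`, `0 < a₁`. [cite: Balaban1988Convergent, (2.4) p.255, (2.10) p.256, (2.28) p.259, (2.34)–(2.39) p.261; Balaban1987RG1, (0.21) p.256; Balaban1985Variational, Thm 1 p.279 (bookkeeping)] -/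
theorem stage12NumericsOfThm1_pos (hε : 0 < ε₀) (hB : 0 ≤ B₃) (ha₀ : 0 < a₀) (ha₁ : 0 < a₁) : (stage12NumericsOfThm1 ε₀ B₃ a₀ a₁).Pos := by
  refine ⟨⟨hε, ha₀, A0OfThm1_pos hB ha₀ ha₁, ?_, ?_⟩, ?_, ⟨?_, ?_⟩, ?_, ?_, sect2NumericsOfFamily_pos, ?_, ?_, ?_⟩ <;>
    norm_num [stage12NumericsOfThm1, numerics7OfThm1, stage12NumericsOfFamily, stage12NumericsOfRecord, numerics7OfFamily, numerics7OfRecord₁₂,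
      towerNumericsOfRecord₁₂, sect2NumericsOfFamily, sect2NumericsOfRecord₁₂, lfConstsOfFamily, lfConstsOfRecord₁₂]

end Letters

/-! ## §2. Window ⇒ the letter inequalities, in kernel -/

section Window

/-- `g·log(g⁻²) ≤ 1` for `g > 0` (`= 2g·log(1∕g) ≤ 2∕e`, from `log x ≤ x − 1` at `x = 1∕(e·g)`). [folklore] -/
private theorem mul_log_inv_sq_le_one {g : ℝ} (hg : 0 < g) : g * Real.log (g ^ 2)⁻¹ ≤ 1 := by
  have he : 0 < Real.exp 1 := Real.exp_pos 1
  have hx : 0 < (Real.exp 1 * g)⁻¹ := inv_pos.mpr (mul_pos he hg)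
  have h1 : Real.log (Real.exp 1 * g)⁻¹ ≤ (Real.exp 1 * g)⁻¹ - 1 := Real.log_le_sub_one_of_pos hx
  have h2 : Real.log (Real.exp 1 * g)⁻¹ = Real.log g⁻¹ - 1 := by
    rw [mul_inv, Real.log_mul (inv_ne_zero he.ne') (inv_ne_zero hg.ne'), Real.log_inv (Real.exp 1), Real.log_exp]
    ring
  have h3 : g * Real.log g⁻¹ ≤ (Real.exp 1)⁻¹ := by
    have h4 : Real.log g⁻¹ ≤ (Real.exp 1 * g)⁻¹ := by linarith
    calc g * Real.log g⁻¹ ≤ g * (Real.exp 1 * g)⁻¹ := mul_le_mul_of_nonneg_left h4 hg.le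
      _ = (Real.exp 1)⁻¹ := by field_simp
  have h5 : Real.log (g ^ 2)⁻¹ = 2 * Real.log g⁻¹ := by
    rw [← inv_pow, Real.log_pow]
    norm_num
  have h6 : (Real.exp 1)⁻¹ ≤ 1 / 2 := by
    rw [inv_le_comm₀ he (by norm_num : (0 : ℝ) < 1 / 2)]
    have h7 := Real.add_one_le_exp (1 : ℝ)
    norm_num at h7 ⊢
    linarith
  rw [h5]
  calc g * (2 * Real.log g⁻¹) = 2 * (g * Real.log g⁻¹) := by ring
    _ ≤ 2 * (Real.exp 1)⁻¹ := by linarith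
    _ ≤ 1 := by linarith

/-- **THE THRESHOLDS ARE BOUNDED BY THE PROFILE CONSTANT** at `p₀ = 1`: `ε_m = g_m·A₀·log g_m⁻² ≤ A₀` for `0 < g_m` (`0 ≤ A₀`).
[cite: Balaban1988Convergent, (2.4) p.255 (elementary)] -/
theorem epsOfRecord_le_A₀_of_p₀_eq_one (ν : Stage7Numerics) (hp : ν.p₀ = 1) (hA : 0 ≤ ν.A₀) {g : ℕ → ℝ} {m : ℕ} (hg : 0 < g m) :
    epsOfRecord ν g m ≤ ν.A₀ := by
  unfold epsOfRecord p0Profile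
  rw [hp, pow_one]
  calc g m * (ν.A₀ * Real.log (g m ^ 2)⁻¹) = ν.A₀ * (g m * Real.log (g m ^ 2)⁻¹) := by ring
    _ ≤ ν.A₀ * 1 := mul_le_mul_of_nonneg_left (mul_log_inv_sq_le_one hg) hA
    _ = ν.A₀ := mul_one _

/-- In the window `]0, ½]`: `g² ≤ ¼ ≤ e⁻¹`. [cite: Balaban1988Convergent, (2.4)–(2.6) p.255 (elementary)] -/
theorem sq_le_exp_neg_one_of_le_half {g : ℝ} (h0 : 0 ≤ g) (h : g ≤ 1 / 2) : g ^ 2 ≤ Real.exp (-1) := by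
  have h1 : g ^ 2 ≤ 1 / 4 := by nlinarith
  have h2 : (1 / 4 : ℝ) ≤ Real.exp (-1) := by
    rw [Real.exp_neg, le_inv_comm₀ (by norm_num) (Real.exp_pos 1)]
    have h3 := Real.exp_one_lt_d9
    norm_num at h3 ⊢
    linarith
  exact h1.trans h2

/-- Along a history in the window `]0, ½]` up to the level `n`: `0 < g_m` and `g_m² ≤ e⁻¹` for `m ≤ n` (the input of def-P11's `bg_numerics_of_letters`).
[cite: Balaban1988Convergent, (2.4)–(2.6) p.255; Balaban1987RG1, Thm 1 p.259] -/
theorem window_sq_le_of_inInterval {γ : ℝ} (hγ : γ ≤ 1 / 2) {g : ℕ → ℝ} {n : ℕ} (hw : Step.InInterval γ n g) :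
    ∀ m, m ≤ n → 0 < g m ∧ g m ^ 2 ≤ Real.exp (-1) := fun m hm =>
  ⟨(hw m hm).1, sq_le_exp_neg_one_of_le_half (hw m hm).1.le ((hw m hm).2.trans hγ)⟩

variable {ε₀ B₃ a₀ a₁ : ℝ}

/-- **★ def-P11's NUMERICS CLAUSES (hnum) AT THE [15]-KEYED NUMERICS, along every history in a window `]0, γ]`, `γ < 1`**: `0 < cR·ε_m`, `cR·ε_m ≤ a₁`,
`B₃·cR·ε_m ≤ εreg` for `m ≤ n` — with `cR = 1`, `εreg = a₀`, `ε_m ≤ A₀ ≤ a₁`, `B₃·A₀ ≤ a₀`. [cite: Balaban1988Convergent, (2.4) p.255, (2.10) p.256, (2.12) p.256; Balaban1985Variational, Thm 1 (7)–(8) p.279] -/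
theorem numerics_thm1_of_inInterval (hB : 0 ≤ B₃) (ha₀ : 0 < a₀) (ha₁ : 0 < a₁) {γ : ℝ} (hγ : γ < 1) {g : ℕ → ℝ} {n : ℕ}
    (hw : Step.InInterval γ n g) : ∀ m, m ≤ n →
      0 < (stage12NumericsOfThm1 ε₀ B₃ a₀ a₁).s2.cR * epsOfRecord (stage12NumericsOfThm1 ε₀ B₃ a₀ a₁).ν g m ∧
      (stage12NumericsOfThm1 ε₀ B₃ a₀ a₁).s2.cR * epsOfRecord (stage12NumericsOfThm1 ε₀ B₃ a₀ a₁).ν g m ≤ a₁ ∧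
      B₃ * ((stage12NumericsOfThm1 ε₀ B₃ a₀ a₁).s2.cR * epsOfRecord (stage12NumericsOfThm1 ε₀ B₃ a₀ a₁).ν g m) ≤
        (stage12NumericsOfThm1 ε₀ B₃ a₀ a₁).ν.εreg := by
  intro m hm
  rw [stage12NumericsOfThm1_cR, one_mul, stage12NumericsOfThm1_ν, numerics7OfThm1_εreg]
  have hA : 0 < (numerics7OfThm1 ε₀ B₃ a₀ a₁).A₀ := A0OfThm1_pos hB ha₀ ha₁
  have hle : epsOfRecord (numerics7OfThm1 ε₀ B₃ a₀ a₁) g m ≤ A0OfThm1 B₃ a₀ a₁ :=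
    epsOfRecord_le_A₀_of_p₀_eq_one _ rfl hA.le (hw m hm).1
  exact ⟨epsOfRecord_pos _ hA (hw m hm).1 ((hw m hm).2.trans_lt hγ), hle.trans (A0OfThm1_le_a₁ hB ha₀.le ha₁.le),
    (mul_le_mul_of_nonneg_left hle hB).trans (mul_A0OfThm1_le_a₀ hB ha₀.le)⟩

/-- The «C₀ sufficiently large» inequality at the [15]-keyed numerics: `B₃·cR·A₀ ≤ (1 − β)·C₀` (`B₃·A₀ ≤ ½ ≤ ¾ = (1 − ¼)·1`). [cite: Balaban1988Convergent, (2.28) p.259, (2.34) p.261] -/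
theorem mul_A0_le_C₀_thm1 (hB : 0 ≤ B₃) :
    B₃ * (stage12NumericsOfThm1 ε₀ B₃ a₀ a₁).s2.cR * (stage12NumericsOfThm1 ε₀ B₃ a₀ a₁).ν.A₀ ≤
      (1 - (stage12NumericsOfThm1 ε₀ B₃ a₀ a₁).s2.βc) * (stage12NumericsOfThm1 ε₀ B₃ a₀ a₁).s2.lf.C₀ := by
  rw [stage12NumericsOfThm1_cR, mul_one, stage12NumericsOfThm1_ν, numerics7OfThm1_A₀, stage12NumericsOfThm1_βc, stage12NumericsOfThm1_lf]
  have h := mul_A0OfThm1_le_half (a₀ := a₀) (a₁ := a₁) hB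
  norm_num [lfConstsOfFamily, lfConstsOfRecord₁₂]
  linarith

/-- … and its sign `0 ≤ B₃·cR·A₀`. [cite: Balaban1988Convergent, (2.28) p.259 (bookkeeping)] -/
theorem mul_A0_nonneg_thm1 (hB : 0 ≤ B₃) (ha₀ : 0 ≤ a₀) (ha₁ : 0 ≤ a₁) :
    0 ≤ B₃ * (stage12NumericsOfThm1 ε₀ B₃ a₀ a₁).s2.cR * (stage12NumericsOfThm1 ε₀ B₃ a₀ a₁).ν.A₀ := by
  rw [stage12NumericsOfThm1_cR, mul_one, stage12NumericsOfThm1_ν, numerics7OfThm1_A₀]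
  exact mul_nonneg hB (A0OfThm1_nonneg hB ha₀ ha₁)

end Window

/-! ## §3. ★★ THE [15]-KEYED WITNESS `θ₁₅ = theta13OfThm1 F N ε₀ ε₂₉ B₃ a₀ a₁` and its faces -/

section Witness

variable (F : T4Family) (N : ℕ) [NeZero N] (ε₀ ε₂₉ B₃ a₀ a₁ : ℝ)

/-- **THE [15]-KEYED STAGE-13 WITNESS** `θ₁₅(ε₀, ε₂₉; B₃, a₀, a₁)`: the all-numerics live witness family (FILE 9 §3) AT `stage12NumericsOfThm1 ε₀ B₃ a₀ a₁`, with K0b's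
residuals of record — the ONE-DEF RE-PIN at which node00-def-P11's numerics clauses are theorems. [cite: Balaban1989LargeFieldI, (0.3) p.176 and p.177; Balaban1988Convergent, (2.4) p.255, (2.10) p.256, (2.28) p.259; Balaban1985Variational, Thm 1 p.279 (bookkeeping witness)] -/
def theta13OfThm1 : Stage13Params F N :=
  theta13LiveOfNumerics F N (stage12NumericsOfThm1 ε₀ B₃ a₀ a₁) ε₂₉
    (zeta316OfRecord F N (stage12NumericsOfThm1 ε₀ B₃ a₀ a₁).ν (stage12NumericsOfThm1 ε₀ B₃ a₀ a₁).τ9.M (stage12NumericsOfThm1 ε₀ B₃ a₀ a₁).A₁)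
    (RzOfRecord F N) (ZtOfRecord F N)

/-- Unfolding: `θ₁₅` IS the member of the all-numerics family (`rfl`). [cite: Balaban1989LargeFieldI, (0.3) p.176 (bookkeeping)] -/
theorem theta13OfThm1_eq :
    theta13OfThm1 F N ε₀ ε₂₉ B₃ a₀ a₁ =
      theta13LiveOfNumerics F N (stage12NumericsOfThm1 ε₀ B₃ a₀ a₁) ε₂₉
        (zeta316OfRecord F N (stage12NumericsOfThm1 ε₀ B₃ a₀ a₁).ν (stage12NumericsOfThm1 ε₀ B₃ a₀ a₁).τ9.M (stage12NumericsOfThm1 ε₀ B₃ a₀ a₁).A₁)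
        (RzOfRecord F N) (ZtOfRecord F N) := rfl

/-- `θ₁₅.ν = numerics7OfThm1 ε₀ B₃ a₀ a₁` (`rfl`). [cite: Balaban1988Convergent, (2.4) p.255 (bookkeeping)] -/
theorem theta13OfThm1_ν : (theta13OfThm1 F N ε₀ ε₂₉ B₃ a₀ a₁).ν = numerics7OfThm1 ε₀ B₃ a₀ a₁ := rfl

/-- `θ₁₅.ν.εreg = a₀` (`rfl`). [cite: Balaban1985Variational, Thm 1 p.279 (bookkeeping)] -/
theorem theta13OfThm1_εreg : (theta13OfThm1 F N ε₀ ε₂₉ B₃ a₀ a₁).ν.εreg = a₀ := rfl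

/-- `θ₁₅.ν.A₀ = A₀(B₃, a₀, a₁)` (`rfl`). [cite: Balaban1988Convergent, (2.4) p.255 (bookkeeping)] -/
theorem theta13OfThm1_A₀ : (theta13OfThm1 F N ε₀ ε₂₉ B₃ a₀ a₁).ν.A₀ = A0OfThm1 B₃ a₀ a₁ := rfl

/-- `θ₁₅.ν.p₀ = 1` (`rfl`). [cite: Balaban1988Convergent, (2.4) p.255 (bookkeeping)] -/
theorem theta13OfThm1_p₀ : (theta13OfThm1 F N ε₀ ε₂₉ B₃ a₀ a₁).ν.p₀ = 1 := rfl

/-- `θ₁₅.ν.ε₀ = ε₀` (`rfl`). [cite: Balaban1987RG1, (1.2) p.260 (bookkeeping)] -/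
theorem theta13OfThm1_ε₀ : (theta13OfThm1 F N ε₀ ε₂₉ B₃ a₀ a₁).ν.ε₀ = ε₀ := rfl

/-- `θ₁₅.ε₂₉ = ε₂₉` (`rfl`). [cite: Balaban1987RG1, (2.9) p.266 (bookkeeping)] -/
theorem theta13OfThm1_ε₂₉ : (theta13OfThm1 F N ε₀ ε₂₉ B₃ a₀ a₁).ε₂₉ = ε₂₉ := rfl

/-- `θ₁₅.γ = ½` (`rfl`). [cite: Balaban1987RG1, Thm 1 p.255 (bookkeeping)] -/
theorem theta13OfThm1_γ : (theta13OfThm1 F N ε₀ ε₂₉ B₃ a₀ a₁).γ = 1 / 2 := rfl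

/-- `θ₁₅.s2 = sect2NumericsOfFamily` (`rfl`). [cite: Balaban1988Convergent, (2.28) p.259 (bookkeeping)] -/
theorem theta13OfThm1_s2 : (theta13OfThm1 F N ε₀ ε₂₉ B₃ a₀ a₁).s2 = sect2NumericsOfFamily := rfl

/-- `θ₁₅.s2.lf.κ = 2·10⁴` (`rfl`). [cite: Balaban1987RG1, (1.18) p.263 (bookkeeping)] -/
theorem theta13OfThm1_κ : (theta13OfThm1 F N ε₀ ε₂₉ B₃ a₀ a₁).s2.lf.κ = 20000 := rfl

/-- The term constants of record at `θ₁₅` ARE the family's with `γ = ½` (`rfl`). [cite: Balaban1988Convergent, (2.28) p.259 (bookkeeping)] -/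
theorem lfOfRecord₁₂_theta13OfThm1 :
    lfOfRecord₁₂ F N (theta13OfThm1 F N ε₀ ε₂₉ B₃ a₀ a₁).toStage12Params = { lfConstsOfFamily with γ := 1 / 2 } := rfl

/-- `θ₁₅.τ9.M = 1` (`rfl`). [cite: Balaban1989LargeFieldI, (2.1) p.182 (bookkeeping)] -/
theorem theta13OfThm1_τ9_M : (theta13OfThm1 F N ε₀ ε₂₉ B₃ a₀ a₁).τ9.M = 1 := rfl

/-- `θ₁₅.A₁ = 1` (`rfl`). [cite: Balaban1987RG1, (1.16) p.262 (bookkeeping)] -/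
theorem theta13OfThm1_A₁ : (theta13OfThm1 F N ε₀ ε₂₉ B₃ a₀ a₁).A₁ = 1 := rfl

/-- `θ₁₅.Rz = RzOfRecord F N` (`rfl`). [cite: Balaban1988Convergent, (2.21) p.258 (bookkeeping)] -/
theorem theta13OfThm1_Rz : (theta13OfThm1 F N ε₀ ε₂₉ B₃ a₀ a₁).Rz = RzOfRecord F N := rfl

/-- `θ₁₅.ℓ₆ + 1 = F.L`. [cite: Balaban1987RG1, (0.1) p.251 (bookkeeping)] -/
theorem theta13OfThm1_ℓ₆_succ : (theta13OfThm1 F N ε₀ ε₂₉ B₃ a₀ a₁).ℓ₆ + 1 = F.L := stage3OfFamily_ℓ₆_succ F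

/-- N10's Lemma-3 level-T binder at `θ₁₅`: `8 ≤ θ.ℓ₆ + 1`. [cite: Balaban1987RG1, (0.1) p.251; Balaban1988RG2Cluster, (2.36) p.19] -/
theorem eight_le_L_theta13OfThm1 : 8 ≤ (theta13OfThm1 F N ε₀ ε₂₉ B₃ a₀ a₁).ℓ₆ + 1 := eight_le_L_stage3OfFamily F

/-- Row N1 at `θ₁₅`: the (D4) `tree` numeral. [cite: Balaban1987RG1, (0.25)–(0.26) p.257] -/
theorem kp_tree_theta13OfThm1 : 128 * Real.log 162 ≤ (theta13OfThm1 F N ε₀ ε₂₉ B₃ a₀ a₁).s2.lf.κ := kp_tree_lfConstsOfFamily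

/-- Row N1 at `θ₁₅`: the (D4) `large` numeral at the family's block size. [cite: Balaban1987RG1, (0.25)–(0.26) p.257; Balaban1988RG2Cluster, p.21 (after (2.39))] -/
theorem kp_large_theta13OfThm1 :
    10 * (64 * Real.log 162 + 1) ≤
      (((((theta13OfThm1 F N ε₀ ε₂₉ B₃ a₀ a₁).ℓ₆ + 1 : ℕ) : ℝ)) / 2 - 1) * (theta13OfThm1 F N ε₀ ε₂₉ B₃ a₀ a₁).s2.lf.κ := by
  rw [theta13OfThm1_ℓ₆_succ, theta13OfThm1_s2, sect2NumericsOfFamily_lf]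
  have h3 : 3 ≤ F.L := by have := F.hL11; omega
  exact kp_large_lfConstsOfFamily_of_three_le h3

/-- Row N1 at `θ₁₅`: N10's rate threshold. [cite: Balaban1987RG1, (1.18) p.263 (bookkeeping numeral)] -/
theorem kp_n10_theta13OfThm1 : (2 * 10 ^ 4 : ℝ) ≤ (theta13OfThm1 F N ε₀ ε₂₉ B₃ a₀ a₁).s2.lf.κ := kp_n10_lfConstsOfFamily

/-- `θ₁₅` carries K0b's residuals of record (`⟨rfl, rfl, rfl⟩`). [cite: Balaban1988Convergent, (3.16) p.268, (2.21) p.258, (3.20) p.269 (bookkeeping)] -/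
theorem hasResidualsOfRecord_theta13OfThm1 : (theta13OfThm1 F N ε₀ ε₂₉ B₃ a₀ a₁).HasResidualsOfRecord F N :=
  hasResidualsOfRecord_theta13LiveOfNumerics F N (stage12NumericsOfThm1 ε₀ B₃ a₀ a₁) ε₂₉

/-- **… hence `ZtUnity` at `θ₁₅`** (row Z). [cite: Balaban1988Convergent, (3.16)–(3.20) pp.268–269] -/
theorem ztUnity_theta13OfThm1 : (theta13OfThm1 F N ε₀ ε₂₉ B₃ a₀ a₁).ZtUnity F N :=
  ztUnity_theta13LiveOfNumerics F N (stage12NumericsOfThm1 ε₀ B₃ a₀ a₁) ε₂₉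

variable {ε₀ ε₂₉ B₃ a₀ a₁} in
/-- **`θ₁₅` IS STAGE-13 ADMISSIBLE under the signs `0 < ε₀`, `0 < ε₂₉`, `0 ≤ B₃`, `0 < a₀`, `0 < a₁`** (row G). [cite: Balaban1987RG1, (0.21) p.256, (1.2) p.260, (2.9) p.266; Balaban1988Convergent, (2.10) p.256; Balaban1985Variational, Thm 1 p.279 (bookkeeping witness)] -/
theorem admissible_theta13OfThm1 (hε : 0 < ε₀) (hε' : 0 < ε₂₉) (hB : 0 ≤ B₃) (ha₀ : 0 < a₀) (ha₁ : 0 < a₁) :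
    (theta13OfThm1 F N ε₀ ε₂₉ B₃ a₀ a₁).Admissible F N :=
  admissible_theta13LiveOfNumerics F N _ _ _ (stage12NumericsOfThm1_pos hε hB ha₀ ha₁) hε'

/-- **★ Row P12 at `θ₁₅` from `Provisos₁₃` there alone.** [cite: Balaban1988Convergent, (3.22) p.269, (3.24) p.270; Balaban1989LargeFieldI, (0.3)–(0.4) p.176] -/
theorem slotsNondegenerate₁₃_theta13OfThm1 (h : (theta13OfThm1 F N ε₀ ε₂₉ B₃ a₀ a₁).Provisos₁₃ F N) :
    (theta13OfThm1 F N ε₀ ε₂₉ B₃ a₀ a₁).SlotsNondegenerate₁₃ F N :=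
  slotsNondegenerate₁₃_theta13LiveOfNumerics F N (stage12NumericsOfThm1 ε₀ B₃ a₀ a₁) ε₂₉ _ _ _ h

end Witness

end Literature.MathematicalPhysics.QuantumFieldTheory.Balaban1983to89.Node00

end
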